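import Literature.AlgebraicGeometry.Resolution.RationalFunctionsToProjectiveSpace
import Literature.AlgebraicGeometry.Motives.GeneratingSectionsRatFn
import HarnessLib

/-!
# The ruled-join rational map `((x : u), (y : v)) ↦ (v·x : u·y)` as a morphism

Topic: `Literature/AlgebraicGeometry/Resolution`. Let `Z` be an integral scheme over a field `k`
with two morphisms `g₁ : Z → ℙ^{a+1}_k`, `g₂ : Z → ℙ^{b+1}_k`; write `(x₀ : … : x_a : u)` and
`(y₀ : … : y_b : v)` for the homogeneous coordinates (the LAST coordinate is distinguished).
Shioda–Katsura's rational map (Tôhoku Math. J. 31 (1979), (1.8), there for Fermat varieties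
`Xʳₘ × Xˢₘ ⇢ Xʳ⁺ˢₘ`, `((x : u), (y : v)) ↦ (v x₀ : … : v x_a : ε u y₀ : … : ε u y_b)`) is the
rational map to `ℙ^{a+b+1}` with vector of homogeneous coordinates, in `K(Z)`,
`ζ = ([v/y_{j₀}]·[xᵢ/x_{i₀}])_{i ≤ a} ⧺ ([u/x_{i₀}]·[y_j/y_{j₀}])_{j ≤ b}` (`joinRatFn`; the twist
`ε` is a diagonal automorphism of the target and is omitted). Restricted to the locus
`u = v = 0` of a blow-up along `{u = 0} × {v = 0}` it is the classical **ruled join**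
`(x, y, (s : t)) ↦ (s x : t y)` of the two factors (Shioda, Math. Ann. 245 (1979), proof of
Thm. I; Harris, *Algebraic Geometry*, Ex. 8.1), whence the name. This file PROVES
(`Resolution/RationalFunctionsToProjectiveSpace`, Hartshorne II Thm. 7.1):

* `mem_lsChart_inl` / `mem_lsChart_inr` — at a point `z` over `D₊(xᵢ) × D₊(y_j)` the rational map
  `ζ` is defined through the chart of `v xᵢ` as soon as `[u/xᵢ]/[v/y_j]` is regular at `z`, and
  through the chart of `u y_j` as soon as `[v/y_j]/[u/xᵢ]` is;
* `isDefinedAt_joinRatFn` — hence `ζ` is defined everywhere if near every point one of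
  `u/xᵢ`, `v/y_j` divides the other (hypothesis `hZ`; the situation on the blow-up of
  `{u = 0} × {v = 0}`, where the quotient is the exceptional coordinate), and
  `joinMap` — the resulting morphism `Z → ℙᴺ_k`, `N + 1 = (a+1) + (b+1)`, over `k`.

Definitions (data only, no named fact): `coordFn` (`[x_j/xᵢ] ∈ K(Z)`), `joinRatFn` (`ζ`),
`joinMap`; the index abbreviations `inl`, `inr`.

## References

* T. Shioda, T. Katsura, On Fermat varieties, Tôhoku Math. J. 31 (1979) 97–115, §1 (1.8) and
  Thm. 1.7 (i). [ShiodaKatsura1979]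
* T. Shioda, The Hodge conjecture for Fermat varieties, Math. Ann. 245 (1979) 175–184, proof of
  Thm. I (the lines joining `{y = 0}` and `{x = 0}`). [Shioda1979HodgeFermat]
* R. Hartshorne, *Algebraic Geometry* (1977), II Thm. 7.1. [Hartshorne1977]
-/

noncomputable section

open CategoryTheory CategoryTheory.Limits AlgebraicGeometry TopologicalSpace Opposite
open Literature.AlgebraicGeometry.Motives Literature.AlgebraicGeometry.Motives.Segre
open Literature.AlgebraicGeometry.Motives.RatFn

attribute [local instance] MvPolynomial.gradedAlgebra

namespace Literature.AlgebraicGeometry.Resolution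

universe u

namespace RuledJoin

variable {k : Type u} [Field k] {Z : Scheme.{u}} [IsIntegral Z]

/-! ## Coordinate ratios as rational functions -/

section CoordFn

variable {ι : Type} (r : Z ⟶ Proj (grading ι k)) {i : ι}
  (hi : genericPoint Z ∈ GeneratingSections.preU r i)

/-- **`[x_j/xᵢ] ∈ K(Z)`**: the rational function of the pulled-back ratio `r^*(x_j/xᵢ)`
(`GeneratingSections.homRatio`) of a morphism `r : Z → ℙ(ι)` whose image is not inside `V₊(xᵢ)`.
[cite: Hartshorne1977, II Thm. 7.1 (a)] -/
def coordFn (j : ι) : Z.functionField :=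
  ofSection hi (GeneratingSections.homRatio r i j)

/-- `[xᵢ/xᵢ] = 1`. [folklore] -/
theorem coordFn_self : coordFn r hi i = 1 := by
  rw [coordFn, GeneratingSections.homRatio_self, ofSection_one]

/-- `[x_j/xᵢ] ≠ 0` when the image is not inside `V₊(x_j)` either. [folklore] -/
theorem coordFn_ne_zero {j : ι} (hj : genericPoint Z ∈ GeneratingSections.preU r j) :
    coordFn r hi j ≠ 0 :=
  GeneratingSections.ofSection_ratio_ne_zero (GeneratingSections.ofHom r) hi hj

/-- **Change of base chart**: `[x_j/xᵢ] / [x_l/xᵢ] = [x_j/x_l]`. [folklore] -/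
theorem coordFn_div {l : ι} (hl : genericPoint Z ∈ GeneratingSections.preU r l) (j : ι) :
    coordFn r hi j / coordFn r hi l = coordFn r hl j :=
  (GeneratingSections.ofSection_ratio_eq_div (GeneratingSections.ofHom r) hi hl j).symm

/-- `[x_j/xᵢ]` is regular over `D₊(xᵢ)`. [folklore] -/
theorem isRegularAt_coordFn {z : Z} (hz : z ∈ GeneratingSections.preU r i) (j : ι) :
    IsRegularAt z (coordFn r hi j) :=
  isRegularAt_ofSection hz _

/-- `[x_j/x_l]·` regularity read from the base chart `i`: `[x_j/xᵢ]/[x_l/xᵢ]` is regular over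
`D₊(x_l)`. [folklore] -/
theorem isRegularAt_coordFn_div {z : Z} {l : ι} (hz : z ∈ GeneratingSections.preU r l) (j : ι) :
    IsRegularAt z (coordFn r hi j / coordFn r hi l) := by
  rw [coordFn_div r hi (genericPoint_mem_of_mem hz)]
  exact isRegularAt_coordFn r _ hz j

end CoordFn

/-! ## The vector `ζ = (v·x ; u·y)` -/

section Zeta

variable {a b : ℕ} (g₁ : Z ⟶ Proj (grading (Fin (a + 2)) k))
  (g₂ : Z ⟶ Proj (grading (Fin (b + 2)) k)) {i₀ : Fin (a + 2)} {j₀ : Fin (b + 2)}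
  (h₁ : genericPoint Z ∈ GeneratingSections.preU g₁ i₀)
  (h₂ : genericPoint Z ∈ GeneratingSections.preU g₂ j₀) {N : ℕ} (hN : N + 1 = (a + 1) + (b + 1))

/-- **Shioda–Katsura's vector of homogeneous coordinates** `ζ ∈ K(Z)ᴺ⁺¹`,
`N + 1 = (a+1) + (b+1)`: `ζ = ([v/y_{j₀}]·[xᵢ/x_{i₀}])_{i ≤ a} ⧺ ([u/x_{i₀}]·[y_j/y_{j₀}])_{j ≤ b}`,
i.e. the rational map `((x : u), (y : v)) ↦ (v x : u y)` read through the base charts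
`D₊(x_{i₀})`, `D₊(y_{j₀})` (`u = x_{a+1}`, `v = y_{b+1}` the last coordinates).
[cite: ShiodaKatsura1979, §1 (1.8)] -/
def joinRatFn : Fin (N + 1) → Z.functionField := fun c =>
  Fin.append
    (fun i : Fin (a + 1) => coordFn g₂ h₂ (Fin.last (b + 1)) * coordFn g₁ h₁ i.castSucc)
    (fun j : Fin (b + 1) => coordFn g₁ h₁ (Fin.last (a + 1)) * coordFn g₂ h₂ j.castSucc)
    (Fin.cast hN c)

/-- The index of the coordinate `v·xᵢ` of the target `ℙᴺ`. [folklore] -/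
abbrev inl (i : Fin (a + 1)) : Fin (N + 1) := Fin.cast hN.symm (Fin.castAdd (b + 1) i)

/-- The index of the coordinate `u·y_j` of the target `ℙᴺ`. [folklore] -/
abbrev inr (j : Fin (b + 1)) : Fin (N + 1) := Fin.cast hN.symm (Fin.natAdd (a + 1) j)

/-- `ζ_{inl i} = [v/y_{j₀}]·[xᵢ/x_{i₀}]`. [cite: ShiodaKatsura1979, §1 (1.8)] -/
@[simp] theorem joinRatFn_inl (i : Fin (a + 1)) :
    joinRatFn g₁ g₂ h₁ h₂ hN (inl hN i) =
      coordFn g₂ h₂ (Fin.last (b + 1)) * coordFn g₁ h₁ i.castSucc := by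
  simp only [joinRatFn, inl]
  exact Fin.append_left _ _ i

/-- `ζ_{inr j} = [u/x_{i₀}]·[y_j/y_{j₀}]`. [cite: ShiodaKatsura1979, §1 (1.8)] -/
@[simp] theorem joinRatFn_inr (j : Fin (b + 1)) :
    joinRatFn g₁ g₂ h₁ h₂ hN (inr hN j) =
      coordFn g₁ h₁ (Fin.last (a + 1)) * coordFn g₂ h₂ j.castSucc := by
  simp only [joinRatFn, inr]
  exact Fin.append_right _ _ j

/-- Every index of `Fin (N + 1)` is an `inl i` or an `inr j`. [folklore] -/
theorem inl_or_inr (c : Fin (N + 1)) : (∃ i, c = inl hN i) ∨ (∃ j, c = inr hN j) := by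
  have key : ∀ c' : Fin ((a + 1) + (b + 1)),
      (∃ i, c' = Fin.castAdd (b + 1) i) ∨ (∃ j, c' = Fin.natAdd (a + 1) j) := fun c' => by
    induction c' using Fin.addCases with
    | left i => exact Or.inl ⟨i, rfl⟩
    | right j => exact Or.inr ⟨j, rfl⟩
  rcases key (Fin.cast hN c) with ⟨i, hi⟩ | ⟨j, hj⟩
  · refine Or.inl ⟨i, Fin.ext ?_⟩
    have h' := Fin.val_eq_of_eq hi
    simpa using h'
  · refine Or.inr ⟨j, Fin.ext ?_⟩
    have h' := Fin.val_eq_of_eq hj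
    simpa using h'

variable (hu : genericPoint Z ∈ GeneratingSections.preU g₁ (Fin.last (a + 1)))
  (hv : genericPoint Z ∈ GeneratingSections.preU g₂ (Fin.last (b + 1)))

include hv in
/-- `ζ_{inl i} ≠ 0` over a non-empty `D₊(xᵢ)` (and `Z ⊄ {v = 0}`). [folklore] -/
theorem joinRatFn_inl_ne_zero {i : Fin (a + 1)}
    (hi : genericPoint Z ∈ GeneratingSections.preU g₁ i.castSucc) :
    joinRatFn g₁ g₂ h₁ h₂ hN (inl hN i) ≠ 0 := by
  rw [joinRatFn_inl]
  exact mul_ne_zero (coordFn_ne_zero g₂ h₂ hv) (coordFn_ne_zero g₁ h₁ hi)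

include hu in
/-- `ζ_{inr j} ≠ 0` over a non-empty `D₊(y_j)` (and `Z ⊄ {u = 0}`). [folklore] -/
theorem joinRatFn_inr_ne_zero {j : Fin (b + 1)}
    (hj : genericPoint Z ∈ GeneratingSections.preU g₂ j.castSucc) :
    joinRatFn g₁ g₂ h₁ h₂ hN (inr hN j) ≠ 0 := by
  rw [joinRatFn_inr]
  exact mul_ne_zero (coordFn_ne_zero g₁ h₁ hu) (coordFn_ne_zero g₂ h₂ hj)

/-! ### The ratios of `ζ` in `K(Z)` -/

/-- `ζ_{inl i'}/ζ_{inl i} = [x_{i'}/x_{i₀}]/[xᵢ/x_{i₀}]` (`= [x_{i'}/xᵢ]`). [folklore] -/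
theorem joinRatFn_inl_div_inl (hv0 : coordFn g₂ h₂ (Fin.last (b + 1)) ≠ 0) (i i' : Fin (a + 1)) :
    joinRatFn g₁ g₂ h₁ h₂ hN (inl hN i') / joinRatFn g₁ g₂ h₁ h₂ hN (inl hN i) =
      coordFn g₁ h₁ i'.castSucc / coordFn g₁ h₁ i.castSucc := by
  rw [joinRatFn_inl, joinRatFn_inl, mul_div_mul_left _ _ hv0]

/-- `ζ_{inr j'}/ζ_{inr j} = [y_{j'}/y_{j₀}]/[y_j/y_{j₀}]` (`= [y_{j'}/y_j]`). [folklore] -/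
theorem joinRatFn_inr_div_inr (hu0 : coordFn g₁ h₁ (Fin.last (a + 1)) ≠ 0) (j j' : Fin (b + 1)) :
    joinRatFn g₁ g₂ h₁ h₂ hN (inr hN j') / joinRatFn g₁ g₂ h₁ h₂ hN (inr hN j) =
      coordFn g₂ h₂ j'.castSucc / coordFn g₂ h₂ j.castSucc := by
  rw [joinRatFn_inr, joinRatFn_inr, mul_div_mul_left _ _ hu0]

/-- **`ζ_{inr j'}/ζ_{inl i} = ([u/xᵢ]/[v/y_j]) · [y_{j'}/y_j]`**, all read from the base charts.
[cite: ShiodaKatsura1979, §1 (1.8)] -/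
theorem joinRatFn_inr_div_inl (i : Fin (a + 1)) (j j' : Fin (b + 1))
    (hi0 : coordFn g₁ h₁ i.castSucc ≠ 0) (hj0 : coordFn g₂ h₂ j.castSucc ≠ 0)
    (hv0 : coordFn g₂ h₂ (Fin.last (b + 1)) ≠ 0) :
    joinRatFn g₁ g₂ h₁ h₂ hN (inr hN j') / joinRatFn g₁ g₂ h₁ h₂ hN (inl hN i) =
      (coordFn g₁ h₁ (Fin.last (a + 1)) / coordFn g₁ h₁ i.castSucc) /
        (coordFn g₂ h₂ (Fin.last (b + 1)) / coordFn g₂ h₂ j.castSucc) *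
      (coordFn g₂ h₂ j'.castSucc / coordFn g₂ h₂ j.castSucc) := by
  rw [joinRatFn_inl, joinRatFn_inr]
  field_simp

/-- **`ζ_{inl i'}/ζ_{inr j} = ([v/y_j]/[u/xᵢ]) · [x_{i'}/xᵢ]`**. [cite: ShiodaKatsura1979, §1 (1.8)] -/
theorem joinRatFn_inl_div_inr (i i' : Fin (a + 1)) (j : Fin (b + 1))
    (hi0 : coordFn g₁ h₁ i.castSucc ≠ 0) (hj0 : coordFn g₂ h₂ j.castSucc ≠ 0)
    (hu0 : coordFn g₁ h₁ (Fin.last (a + 1)) ≠ 0) :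
    joinRatFn g₁ g₂ h₁ h₂ hN (inl hN i') / joinRatFn g₁ g₂ h₁ h₂ hN (inr hN j) =
      (coordFn g₂ h₂ (Fin.last (b + 1)) / coordFn g₂ h₂ j.castSucc) /
        (coordFn g₁ h₁ (Fin.last (a + 1)) / coordFn g₁ h₁ i.castSucc) *
      (coordFn g₁ h₁ i'.castSucc / coordFn g₁ h₁ i.castSucc) := by
  rw [joinRatFn_inl, joinRatFn_inr]
  field_simp

/-! ### The charts of the linear system of `ζ` -/

include hv in
/-- **The chart of `v·xᵢ`**: a point `z` over `D₊(xᵢ) × D₊(y_j)` at which `[u/xᵢ]/[v/y_j]` is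
regular lies in the chart `lsChart ζ (inl i)` of the linear system of `ζ` — there
`ζ/ζ_{inl i} = ([x_{i'}/xᵢ])_{i'} ⧺ (([u/xᵢ]/[v/y_j])·[y_{j'}/y_j])_{j'}` is regular.
[cite: ShiodaKatsura1979, §1 Thm. 1.7 (i)] [cite: Hartshorne1977, II Thm. 7.1 (proof)] -/
theorem mem_lsChart_inl {z : Z} {i : Fin (a + 1)} {j : Fin (b + 1)}
    (hz₁ : z ∈ GeneratingSections.preU g₁ i.castSucc) (hz₂ : z ∈ GeneratingSections.preU g₂ j.castSucc)
    (hreg : IsRegularAt z ((coordFn g₁ h₁ (Fin.last (a + 1)) / coordFn g₁ h₁ i.castSucc) /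
      (coordFn g₂ h₂ (Fin.last (b + 1)) / coordFn g₂ h₂ j.castSucc))) :
    z ∈ lsChart (joinRatFn g₁ g₂ h₁ h₂ hN) (inl hN i) := by
  have hi := genericPoint_mem_of_mem hz₁
  have hj := genericPoint_mem_of_mem hz₂
  have hi0 := coordFn_ne_zero g₁ h₁ hi
  have hj0 := coordFn_ne_zero g₂ h₂ hj
  have hv0 := coordFn_ne_zero g₂ h₂ hv
  refine (mem_lsChart_iff _).mpr ⟨joinRatFn_inl_ne_zero g₁ g₂ h₁ h₂ hN hv hi, fun c => ?_⟩
  rcases inl_or_inr hN c with ⟨i', rfl⟩ | ⟨j', rfl⟩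
  · rw [joinRatFn_inl_div_inl g₁ g₂ h₁ h₂ hN hv0]
    exact isRegularAt_coordFn_div g₁ h₁ hz₁ _
  · rw [joinRatFn_inr_div_inl g₁ g₂ h₁ h₂ hN i j j' hi0 hj0 hv0]
    exact hreg.mul (isRegularAt_coordFn_div g₂ h₂ hz₂ _)

include hu in
/-- **The chart of `u·y_j`**: a point `z` over `D₊(xᵢ) × D₊(y_j)` at which `[v/y_j]/[u/xᵢ]` is
regular lies in the chart `lsChart ζ (inr j)`. [cite: ShiodaKatsura1979, §1 Thm. 1.7 (i)]
[cite: Hartshorne1977, II Thm. 7.1 (proof)] -/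
theorem mem_lsChart_inr {z : Z} {i : Fin (a + 1)} {j : Fin (b + 1)}
    (hz₁ : z ∈ GeneratingSections.preU g₁ i.castSucc) (hz₂ : z ∈ GeneratingSections.preU g₂ j.castSucc)
    (hreg : IsRegularAt z ((coordFn g₂ h₂ (Fin.last (b + 1)) / coordFn g₂ h₂ j.castSucc) /
      (coordFn g₁ h₁ (Fin.last (a + 1)) / coordFn g₁ h₁ i.castSucc))) :
    z ∈ lsChart (joinRatFn g₁ g₂ h₁ h₂ hN) (inr hN j) := by
  have hi := genericPoint_mem_of_mem hz₁
  have hj := genericPoint_mem_of_mem hz₂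
  have hi0 := coordFn_ne_zero g₁ h₁ hi
  have hj0 := coordFn_ne_zero g₂ h₂ hj
  have hu0 := coordFn_ne_zero g₁ h₁ hu
  refine (mem_lsChart_iff _).mpr ⟨joinRatFn_inr_ne_zero g₁ g₂ h₁ h₂ hN hu hj, fun c => ?_⟩
  rcases inl_or_inr hN c with ⟨i', rfl⟩ | ⟨j', rfl⟩
  · rw [joinRatFn_inl_div_inr g₁ g₂ h₁ h₂ hN i i' j hi0 hj0 hu0]
    exact hreg.mul (isRegularAt_coordFn_div g₁ h₁ hz₁ _)
  · rw [joinRatFn_inr_div_inr g₁ g₂ h₁ h₂ hN hu0]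
    exact isRegularAt_coordFn_div g₂ h₂ hz₂ _

/-! ### The ratio sections of the linear system on the two kinds of charts -/

include hv in
/-- **On the chart of `v·xᵢ`, the ratio section `ζ_{inl i'}/ζ_{inl i}` is `x_{i'}/xᵢ`** (restricted
to any non-empty open `W ⊆ lsChart ζ (inl i)` over `D₊(xᵢ)`). [cite: Hartshorne1977, II Thm. 7.1 (proof)] -/
theorem map_lsRatio_inl_inl {W : Z.Opens} {i : Fin (a + 1)}
    (hW₁ : W ≤ GeneratingSections.preU g₁ i.castSucc)
    (hW : W ≤ lsChart (joinRatFn g₁ g₂ h₁ h₂ hN) (inl hN i)) (hη : genericPoint Z ∈ W)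
    (i' : Fin (a + 1)) :
    Z.presheaf.map (homOfLE hW).op (lsRatio (joinRatFn g₁ g₂ h₁ h₂ hN) (inl hN i) (inl hN i')) =
      Z.presheaf.map (homOfLE hW₁).op (GeneratingSections.homRatio g₁ i.castSucc i'.castSucc) := by
  have hi : genericPoint Z ∈ GeneratingSections.preU g₁ i.castSucc := hW₁ hη
  have hv0 := coordFn_ne_zero g₂ h₂ hv
  apply ofSection_injective hη
  rw [ofSection_map, ofSection_map, ofSection_lsRatio _ (joinRatFn_inl_ne_zero g₁ g₂ h₁ h₂ hN hv hi),
    joinRatFn_inl_div_inl g₁ g₂ h₁ h₂ hN hv0, coordFn_div g₁ h₁ hi]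
  rfl

include hv in
/-- **On the chart of `v·xᵢ`, the ratio section `ζ_{inr j'}/ζ_{inl i}` is `T · (y_{j'}/y_j)`** for
any section `T` over `W` with rational function `[u/xᵢ]/[v/y_j]` (`W ⊆ lsChart ζ (inl i)` a
non-empty open over `D₊(xᵢ) × D₊(y_j)`; on the blow-up `T` is the exceptional coordinate).
[cite: ShiodaKatsura1979, §1 Thm. 1.7 (i)] [cite: Hartshorne1977, II Thm. 7.1 (proof)] -/
theorem map_lsRatio_inl_inr {W : Z.Opens} {i : Fin (a + 1)} {j : Fin (b + 1)}
    (hW₁ : W ≤ GeneratingSections.preU g₁ i.castSucc)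
    (hW₂ : W ≤ GeneratingSections.preU g₂ j.castSucc)
    (hW : W ≤ lsChart (joinRatFn g₁ g₂ h₁ h₂ hN) (inl hN i)) (hη : genericPoint Z ∈ W)
    (T : Γ(Z, W)) (hT : ofSection hη T =
      (coordFn g₁ h₁ (Fin.last (a + 1)) / coordFn g₁ h₁ i.castSucc) /
        (coordFn g₂ h₂ (Fin.last (b + 1)) / coordFn g₂ h₂ j.castSucc)) (j' : Fin (b + 1)) :
    Z.presheaf.map (homOfLE hW).op (lsRatio (joinRatFn g₁ g₂ h₁ h₂ hN) (inl hN i) (inr hN j')) =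
      T * Z.presheaf.map (homOfLE hW₂).op (GeneratingSections.homRatio g₂ j.castSucc j'.castSucc) := by
  have hi : genericPoint Z ∈ GeneratingSections.preU g₁ i.castSucc := hW₁ hη
  have hj : genericPoint Z ∈ GeneratingSections.preU g₂ j.castSucc := hW₂ hη
  have hi0 := coordFn_ne_zero g₁ h₁ hi
  have hj0 := coordFn_ne_zero g₂ h₂ hj
  have hv0 := coordFn_ne_zero g₂ h₂ hv
  apply ofSection_injective hη
  rw [ofSection_map, ofSection_mul, ofSection_map,
    ofSection_lsRatio _ (joinRatFn_inl_ne_zero g₁ g₂ h₁ h₂ hN hv hi),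
    joinRatFn_inr_div_inl g₁ g₂ h₁ h₂ hN i j j' hi0 hj0 hv0, hT, coordFn_div g₂ h₂ hj j'.castSucc]
  rfl

include hu in
/-- **On the chart of `u·y_j`, the ratio section `ζ_{inr j'}/ζ_{inr j}` is `y_{j'}/y_j`.**
[cite: Hartshorne1977, II Thm. 7.1 (proof)] -/
theorem map_lsRatio_inr_inr {W : Z.Opens} {j : Fin (b + 1)}
    (hW₂ : W ≤ GeneratingSections.preU g₂ j.castSucc)
    (hW : W ≤ lsChart (joinRatFn g₁ g₂ h₁ h₂ hN) (inr hN j)) (hη : genericPoint Z ∈ W)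
    (j' : Fin (b + 1)) :
    Z.presheaf.map (homOfLE hW).op (lsRatio (joinRatFn g₁ g₂ h₁ h₂ hN) (inr hN j) (inr hN j')) =
      Z.presheaf.map (homOfLE hW₂).op (GeneratingSections.homRatio g₂ j.castSucc j'.castSucc) := by
  have hj : genericPoint Z ∈ GeneratingSections.preU g₂ j.castSucc := hW₂ hη
  have hu0 := coordFn_ne_zero g₁ h₁ hu
  apply ofSection_injective hη
  rw [ofSection_map, ofSection_map, ofSection_lsRatio _ (joinRatFn_inr_ne_zero g₁ g₂ h₁ h₂ hN hu hj),
    joinRatFn_inr_div_inr g₁ g₂ h₁ h₂ hN hu0, coordFn_div g₂ h₂ hj]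
  rfl

include hu in
/-- **On the chart of `u·y_j`, the ratio section `ζ_{inl i'}/ζ_{inr j}` is `T' · (x_{i'}/xᵢ)`** for
any section `T'` over `W` with rational function `[v/y_j]/[u/xᵢ]`.
[cite: ShiodaKatsura1979, §1 Thm. 1.7 (i)] [cite: Hartshorne1977, II Thm. 7.1 (proof)] -/
theorem map_lsRatio_inr_inl {W : Z.Opens} {i : Fin (a + 1)} {j : Fin (b + 1)}
    (hW₁ : W ≤ GeneratingSections.preU g₁ i.castSucc)
    (hW₂ : W ≤ GeneratingSections.preU g₂ j.castSucc)
    (hW : W ≤ lsChart (joinRatFn g₁ g₂ h₁ h₂ hN) (inr hN j)) (hη : genericPoint Z ∈ W)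
    (T' : Γ(Z, W)) (hT' : ofSection hη T' =
      (coordFn g₂ h₂ (Fin.last (b + 1)) / coordFn g₂ h₂ j.castSucc) /
        (coordFn g₁ h₁ (Fin.last (a + 1)) / coordFn g₁ h₁ i.castSucc)) (i' : Fin (a + 1)) :
    Z.presheaf.map (homOfLE hW).op (lsRatio (joinRatFn g₁ g₂ h₁ h₂ hN) (inr hN j) (inl hN i')) =
      T' * Z.presheaf.map (homOfLE hW₁).op (GeneratingSections.homRatio g₁ i.castSucc i'.castSucc) := by
  have hi : genericPoint Z ∈ GeneratingSections.preU g₁ i.castSucc := hW₁ hη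
  have hj : genericPoint Z ∈ GeneratingSections.preU g₂ j.castSucc := hW₂ hη
  have hi0 := coordFn_ne_zero g₁ h₁ hi
  have hj0 := coordFn_ne_zero g₂ h₂ hj
  have hu0 := coordFn_ne_zero g₁ h₁ hu
  apply ofSection_injective hη
  rw [ofSection_map, ofSection_mul, ofSection_map,
    ofSection_lsRatio _ (joinRatFn_inr_ne_zero g₁ g₂ h₁ h₂ hN hu hj),
    joinRatFn_inl_div_inr g₁ g₂ h₁ h₂ hN i i' j hi0 hj0 hu0, hT', coordFn_div g₁ h₁ hi i'.castSucc]
  rfl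

/-! ## Definedness and the morphism -/

/-! The standing hypothesis `hZ` below — **`u/xᵢ` and `v/y_j` are comparable near every
point**: every `z ∈ Z` lies over some `D₊(xᵢ) × D₊(y_j)` (`i ≤ a`, `j ≤ b`) with
`[u/xᵢ]/[v/y_j]` or `[v/y_j]/[u/xᵢ]` regular at `z` — is the situation on the blow-up of
`{u = 0} × {v = 0}`, where on each of the two standard charts one of the two generators of the
centre divides the other (Shioda–Katsura §1 (1.5)–(1.6)); it is spelled out, not named. -/

variable (hZ : ∀ z : Z, ∃ (i : Fin (a + 1)) (j : Fin (b + 1)),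
    z ∈ GeneratingSections.preU g₁ i.castSucc ∧ z ∈ GeneratingSections.preU g₂ j.castSucc ∧
    (IsRegularAt z ((coordFn g₁ h₁ (Fin.last (a + 1)) / coordFn g₁ h₁ i.castSucc) /
        (coordFn g₂ h₂ (Fin.last (b + 1)) / coordFn g₂ h₂ j.castSucc)) ∨
      IsRegularAt z ((coordFn g₂ h₂ (Fin.last (b + 1)) / coordFn g₂ h₂ j.castSucc) /
        (coordFn g₁ h₁ (Fin.last (a + 1)) / coordFn g₁ h₁ i.castSucc))))

include hu hv hZ in
/-- **The rational map `ζ = (v x : u y)` is defined at every point** of a scheme on which `u/xᵢ`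
and `v/y_j` are locally comparable (Shioda–Katsura, Thm. 1.7 (i): the rational map (1.8) extends
to a morphism on the blow-up). [cite: ShiodaKatsura1979, §1 Thm. 1.7 (i)] -/
theorem isDefinedAt_joinRatFn (z : Z) : IsDefinedAt (joinRatFn g₁ g₂ h₁ h₂ hN) z := by
  obtain ⟨i, j, hz₁, hz₂, h | h⟩ := hZ z
  · exact ⟨inl hN i, mem_lsChart_inl g₁ g₂ h₁ h₂ hN hv hz₁ hz₂ h⟩
  · exact ⟨inr hN j, mem_lsChart_inr g₁ g₂ h₁ h₂ hN hu hz₁ hz₂ h⟩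

/-- **The join morphism `Z → ℙᴺ_k`, `N + 1 = (a+1) + (b+1)`**, of the rational map
`((x : u), (y : v)) ↦ (v x : u y)` on a scheme over `k` on which it is everywhere defined
(`Resolution/RationalFunctionsToProjectiveSpace.toProjOfVec`, Hartshorne II Thm. 7.1 (b)).
[cite: ShiodaKatsura1979, §1 Thm. 1.7 (i)] [cite: Hartshorne1977, II Thm. 7.1 (b)] -/
def joinMap (f : Z ⟶ Spec (.of k)) : Z ⟶ Proj (grading (Fin (N + 1)) k) :=
  toProjOfVec (joinRatFn g₁ g₂ h₁ h₂ hN) f (isDefinedAt_joinRatFn g₁ g₂ h₁ h₂ hN hu hv hZ)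

/-- `joinMap` is a morphism over `k`. [cite: Hartshorne1977, II Thm. 7.1 (b)] -/
@[reassoc]
theorem joinMap_toSpec (f : Z ⟶ Spec (.of k)) :
    joinMap g₁ g₂ h₁ h₂ hN hu hv hZ f ≫ toSpec (Fin (N + 1)) k = f :=
  toProjOfVec_toSpec _ _ _

/-- **`joinMap` on a chart of the linear system**: for `g : T → Z` landing in the chart
`lsChart ζ c`, `g ≫ joinMap` is the chart map of the linear system of `ζ` through `D₊(z_c)`
(`comp_toProjOfVec`). [cite: Hartshorne1977, II Thm. 7.1 (proof)] -/
theorem comp_joinMap (f : Z ⟶ Spec (.of k)) {T : Scheme.{u}} (g : T ⟶ Z) {c : Fin (N + 1)}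
    (hg : ⊤ ≤ g ⁻¹ᵁ lsChart (joinRatFn g₁ g₂ h₁ h₂ hN) c) :
    g ≫ joinMap g₁ g₂ h₁ h₂ hN hu hv hZ f =
      (linearSystem (joinRatFn g₁ g₂ h₁ h₂ hN)
        (isDefinedAt_joinRatFn g₁ g₂ h₁ h₂ hN hu hv hZ)).chartMap f c g hg :=
  comp_toProjOfVec _ _ _ g hg

/-- **`joinMap ⁻¹ D₊(z_c)` is the chart `lsChart ζ c`.** [cite: Hartshorne1977, II Thm. 7.1 (b)] -/
theorem joinMap_preimage_basicOpen (f : Z ⟶ Spec (.of k)) (c : Fin (N + 1)) :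
    joinMap g₁ g₂ h₁ h₂ hN hu hv hZ f ⁻¹ᵁ Proj.basicOpen (grading (Fin (N + 1)) k) (MvPolynomial.X c) =
      lsChart (joinRatFn g₁ g₂ h₁ h₂ hN) c :=
  toProjOfVec_preimage_basicOpen _ _ _ c

end Zeta

end RuledJoin

end Literature.AlgebraicGeometry.Resolution

end
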